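import Literature.NumberTheory.EllipticCurves.WeierstrassFormalGroupPoints
import Literature.NumberTheory.EllipticCurves.TateModule
import Literature.NumberTheory.PAdicHodge.AinfWeierstrassHodgeTateGalois
import Literature.NumberTheory.PAdicHodge.AinfWeierstrassOmegaPeriodAdd
import HarnessLib

/-!
# The Tate module `T_pŴ(𝒪_{ℂ_F})` of the formal group of an integral Weierstrass equation, and the three
# period maps `[·]`, `∫ω`, `HT` as bundled `Γ_F`-equivariant homomorphisms

Topic `Literature/NumberTheory/PAdicHodge`; brick (B9c) of the programme
`Summits/…/Cruxes/StarredOptimalManinUnitFiveSeven/Lines/kato-lever-hDR-sector-iii-periods.md` (§1 "NEXT BRICK", §5).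
For `W` a Weierstrass equation over `ℤ`, `p` a prime and `F` a `p`-adic field, the earlier bricks work with
"Tate-module points" in unbundled form: `t : ℕ → 𝔪_{ℂ_F}` with `t₀ = 0` and `[p]_W t_{n+1} = t_n`. Here:

* §1 `Ŵ(𝔪_{ℂ_F}) = W.Pt (maxNilIdealC F)` (tree `WeierstrassFormalGroupPoints`) carries the action of `Γ_F` by group
  automorphisms (`instDistribMulActionPt`, `σ • P = σ(P)` through the isometric action on `ℂ_F`); `p • P = [p]_W P = mulPC P`
  (`val_p_nsmul`); `θ : Ŵ(𝔫) →+ Ŵ(𝔪_{ℂ_F})` (`thetaPt`) and `σ : Ŵ(𝔫) →+ Ŵ(𝔫)` (`galPtN`) on `𝔫 = θ⁻¹(𝔪_ℂ) ⊂ 𝔸_inf`.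
* §2 **`TatePt W F p := TateModule (Ŵ(𝔪_{ℂ_F})) p = T_pŴ(𝒪_{ℂ_F})`** (tree `EllipticCurves/TateModule`: a
  `ℤ_[p]`-module with the componentwise `Γ_F`-action commuting with `ℤ_[p]`, representation `tatePtRep`), and the
  BRIDGE with the unbundled interface: `seq τ`, `seq_zero`, `mulPC_seq`, `ofSeq`, `seq_ofSeq`, `ofSeq_seq`, `seq_add`,
  `seq_smul` (`seq (σ • τ) = galSeq σ (seq τ)`).
* §3 the three landed maps as bundled additive, `Γ_F`-equivariant homomorphisms on `T_pŴ(𝒪_{ℂ_F})`: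
  **`torsionLiftHom`** `τ ↦ [τ] ∈ Ŵ(𝔫)` (Fontaine's element; `torsionLift_addSeq`, `gal_torsionLift`),
  **`omegaPeriodHom`** `τ ↦ ∫_τ ω = log_W([τ]) ∈ Fil¹B_dR⁺` (`omegaPeriod_addSeq`, `gal_omegaPeriod`),
  **`htCoordHom`** `τ ↦ θ([τ]/ξ_dR) ∈ ℂ_F` with `htCoordHom (σ • τ) = c(σ) · σ(htCoordHom τ)` (`htCoord_galSeq`): the
  Hodge–Tate map `T_pŴ → ℂ_F(1)` (Tate 1967 §4, Fontaine 1982 §5).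

All statements proved, std axioms; no named facts. BSD / K★: infrastructure for the supersingular sector of hDR; no
statement about elliptic curves over number fields is proved here. What is NOT here: `ℤ_[p]`-linearity of `∫ω` (needs the
`p`-adic Banach topology on `B_dR⁺/Fil^k`), the matching `T_pŴ ≅ T_pE` at places of good reduction (M1/M2 of the memo),
injectivity of the Hodge–Tate map (N1).

## References
* J. Tate, *p-divisible groups* (1967), §4. [Tate1967]
* J.-M. Fontaine, *Formes différentielles et modules de Tate…*, Invent. Math. 65 (1982), §5. [Fontaine1982FormesDifferentielles]
* J.-M. Fontaine, *Le corps des périodes p-adiques*, Astérisque 223 (1994), Exp. II §1.2, §1.5. [FontaineAsterisque223III]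
* J. H. Silverman, *The Arithmetic of Elliptic Curves* (2009), III.§7, IV.2–IV.3. [SilvermanAEC2009]
-/

noncomputable section

open Ideal Filter Topology Field WittVector MvPowerSeries

namespace Literature.NumberTheory.PAdicHodge

open Literature.NumberTheory.GaloisRepresentations
open Literature.NumberTheory.GaloisRepresentations.IsNonarchimedeanLocalField
open Literature.NumberTheory.GaloisRepresentations.LubinTate
open Literature.NumberTheory.EllipticCurves

namespace AinfTop

/-! ## §1 `Γ_F` acts on `Ŵ(𝔪_{ℂ_F})` by group automorphisms; `θ` and `σ` on `Ŵ(𝔫)` -/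

section ActionC

variable {F : Type} [Field F] [ValuativeRel F] [TopologicalSpace F] [IsNonarchimedeanLocalField F]
  (W : WeierstrassCurve ℤ)

/-- `σ ∈ Γ_F` as a continuous `ℤ`-algebra endomorphism of `𝒪_{ℂ_F}`. [cite: FontaineAsterisque223III, Exp. II §1.2] -/
def galCBallAlgHom (σ : absoluteGaloisGroup F) : CBall F →ₐ[ℤ] CBall F := (galCBall σ).toIntAlgHom

/-- **`σ : Ŵ(𝔪_{ℂ_F}) →+ Ŵ(𝔪_{ℂ_F})`**, `P ↦ σ(P)` (a group homomorphism: `σ` is a continuous ring map fixing the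
integral coefficients of `F_W`). [cite: FontaineAsterisque223III, Exp. II §1.2] -/
def galPt (σ : absoluteGaloisGroup F) : W.Pt (maxNilIdealC F) →+ W.Pt (maxNilIdealC F) :=
  WeierstrassCurve.Pt.map W (maxNilIdealC F) (maxNilIdealC F) (galCBallAlgHom σ) (continuous_galCBall σ)
    fun _ hx => galCBall_mem hx

/-- Unfolding `galPt`. [cite: FontaineAsterisque223III, Exp. II §1.2] -/
@[simp] theorem coe_val_galPt (σ : absoluteGaloisGroup F) (P : W.Pt (maxNilIdealC F)) :
    ((galPt W σ P).val : CBall F) = galCBall σ P.val := rfl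

/-- The action `σ • P := σ(P)` of `Γ_F` on `Ŵ(𝔪_{ℂ_F})`. [cite: FontaineAsterisque223III, Exp. II §1.2] -/
instance instSMulPt : SMul (absoluteGaloisGroup F) (W.Pt (maxNilIdealC F)) := ⟨fun σ P => galPt W σ P⟩

/-- Unfolding the action on coordinates: `(σ • P).val = σ • P.val` in `ℂ_F`. [cite: FontaineAsterisque223III, Exp. II §1.2] -/
@[simp] theorem coe_val_smul (σ : absoluteGaloisGroup F) (P : W.Pt (maxNilIdealC F)) :
    (((σ • P).val : CBall F) : CompletedAlgClosure F) = σ • ((P.val : CBall F) : CompletedAlgClosure F) := rfl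

/-- `σ • P = galPt σ P`. [cite: FontaineAsterisque223III, Exp. II §1.2] -/
theorem smul_def (σ : absoluteGaloisGroup F) (P : W.Pt (maxNilIdealC F)) : σ • P = galPt W σ P := rfl

/-- **`Γ_F` acts on `Ŵ(𝔪_{ℂ_F})` by group automorphisms.** [cite: FontaineAsterisque223III, Exp. II §1.2] -/
instance instDistribMulActionPt : DistribMulAction (absoluteGaloisGroup F) (W.Pt (maxNilIdealC F)) where
  one_smul P := WeierstrassCurve.Pt.ext (Subtype.ext (Subtype.ext (by rw [coe_val_smul, one_smul])))
  mul_smul σ τ P := WeierstrassCurve.Pt.ext (Subtype.ext (Subtype.ext (by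
    rw [coe_val_smul, coe_val_smul, coe_val_smul, mul_smul])))
  smul_zero σ := (galPt W σ).map_zero
  smul_add σ P Q := (galPt W σ).map_add P Q

variable (F) in
/-- The sequence-level action `galSeq` is the action on `Ŵ(𝔪_{ℂ_F})`, componentwise. [cite: FontaineAsterisque223III, Exp. II §1.2] -/
theorem galSeq_eq_smul (σ : absoluteGaloisGroup F) (t : ℕ → (maxNilIdealC F).toIdeal) (n : ℕ) :
    galSeq F σ t n = (σ • (⟨t n⟩ : W.Pt (maxNilIdealC F))).val := rfl

variable (F) {p : ℕ} in
/-- **`p • P = [p]_W(P) = mulPC P`** in `Ŵ(𝔪_{ℂ_F})`. [cite: SilvermanAEC2009, IV.2.3] -/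
theorem val_p_nsmul (P : W.Pt (maxNilIdealC F)) : (p • P).val = mulPC F p W P.val :=
  WeierstrassCurve.Pt.val_nsmul p P

end ActionC

section ActionN

variable {F : Type} [Field F] [ValuativeRel F] [TopologicalSpace F] [IsNonarchimedeanLocalField F]
  {p : ℕ} [Fact p.Prime] [Fact (¬ IsUnit (p : integerC F))]
  [IsAdicComplete (Ideal.span {(p : integerC F)}) (integerC F)] [CharZero F]
  {hθ : Function.Surjective (fontaineTheta (integerC F) p)}
  (W : WeierstrassCurve ℤ)

/-- **`θ : Ŵ(𝔫) →+ Ŵ(𝔪_{ℂ_F})`** on the points of the nil ideal `𝔫 = θ⁻¹(𝔪_ℂ) ⊂ 𝔸_inf` (`θ` is a continuous ring map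
fixing the integral coefficients). [cite: CasselsFrohlichANT1967, Ch. VI §3.2] -/
def thetaPt (hθ : Function.Surjective (fontaineTheta (integerC F) p)) :
    W.Pt (nilTheta F p hθ) →+ W.Pt (maxNilIdealC F) :=
  WeierstrassCurve.Pt.map W (nilTheta F p hθ) (maxNilIdealC F) (thetaAlgHom (A := ℤ) fun a => by simp)
    continuous_theta fun _ hx => theta_mem_maxNilIdealC hx

/-- Unfolding `thetaPt`. [cite: CasselsFrohlichANT1967, Ch. VI §3.2] -/
@[simp] theorem coe_val_thetaPt (P : W.Pt (nilTheta F p hθ)) :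
    ((thetaPt W hθ P).val : CBall F) = theta F p (P.val : AinfTop F p) := rfl

/-- **`σ : Ŵ(𝔫) →+ Ŵ(𝔫)`** for `σ ∈ Γ_F` (`σ` is continuous on `𝔸_inf` and fixes `ℤ`). [cite: FontaineAsterisque223III, Exp. II §1.2] -/
def galPtN (hθ : Function.Surjective (fontaineTheta (integerC F) p)) (σ : absoluteGaloisGroup F) :
    W.Pt (nilTheta F p hθ) →+ W.Pt (nilTheta F p hθ) :=
  WeierstrassCurve.Pt.map W (nilTheta F p hθ) (nilTheta F p hθ) (galAlgHom (A := ℤ) σ fun a => by simp)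
    (continuous_gal σ) fun _ hx => gal_mem_nilTheta σ hx

/-- Unfolding `galPtN`. [cite: FontaineAsterisque223III, Exp. II §1.2] -/
@[simp] theorem coe_val_galPtN (σ : absoluteGaloisGroup F) (P : W.Pt (nilTheta F p hθ)) :
    ((galPtN W hθ σ P).val : AinfTop F p) = gal F p σ (P.val : AinfTop F p) := rfl

/-- `θ ∘ σ = σ ∘ θ` on `Ŵ(𝔫)`. [cite: FontaineAsterisque223III, Exp. II §1.2] -/
theorem thetaPt_galPtN (σ : absoluteGaloisGroup F) (P : W.Pt (nilTheta F p hθ)) :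
    thetaPt W hθ (galPtN W hθ σ P) = σ • thetaPt W hθ P :=
  WeierstrassCurve.Pt.ext (Subtype.ext (Subtype.ext (by
    rw [coe_val_thetaPt, coe_val_galPtN, coe_theta_gal, coe_val_smul, coe_val_thetaPt])))

/-- `p • P = mulP P` in `Ŵ(𝔫)`. [cite: SilvermanAEC2009, IV.2.3] -/
theorem val_p_nsmul_N (P : W.Pt (nilTheta F p hθ)) : (p • P).val = mulP W P.val :=
  WeierstrassCurve.Pt.val_nsmul p P

/-- `P + Q = addW P Q` in `Ŵ(𝔫)`. [cite: CasselsFrohlichANT1967, Ch. VI §3.2] -/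
theorem val_add_N (P Q : W.Pt (nilTheta F p hθ)) : (P + Q).val = addW W P.val Q.val := rfl

end ActionN

/-! ## §2 The Tate module `T_pŴ(𝒪_{ℂ_F})` and the bridge with `[p]`-compatible sequences -/

section Tate

variable {F : Type} [Field F] [ValuativeRel F] [TopologicalSpace F] [IsNonarchimedeanLocalField F]
  {p : ℕ} (W : WeierstrassCurve ℤ)

variable (F p) in
/-- **`T_pŴ(𝒪_{ℂ_F})`**: the Tate module of the group `Ŵ(𝔪_{ℂ_F})` — compatible sequences `(P_n)` with `pⁿ P_n = 0`,
`p P_{n+1} = P_n` (tree `TateModule`; a `ℤ_[p]`-module with a `ℤ_[p]`-linear action of `Γ_F`). [cite: SilvermanAEC2009, III.§7] [cite: Tate1967, §4] -/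
abbrev TatePt : Type := TateModule (W.Pt (maxNilIdealC F)) p

variable (F p) [Fact p.Prime] in
/-- The Galois representation `Γ_F → Aut_{ℤ_p} T_pŴ(𝒪_{ℂ_F})`. [cite: Tate1967, §4] -/
def tatePtRep : Representation ℤ_[p] (absoluteGaloisGroup F) (TatePt F p W) :=
  tateRepresentation (absoluteGaloisGroup F) (W.Pt (maxNilIdealC F)) p

variable [Fact p.Prime] in
/-- Unfolding `tatePtRep`. [cite: Tate1967, §4] -/
@[simp] theorem tatePtRep_apply_apply (σ : absoluteGaloisGroup F) (τ : TatePt F p W) : tatePtRep F p W σ τ = σ • τ := rfl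

/-- The coordinate sequence `(t_n)_n ⊂ 𝔪_{ℂ_F}` of `τ ∈ T_pŴ(𝒪_{ℂ_F})`. [cite: SilvermanAEC2009, III.§7] -/
def seq (τ : TatePt F p W) (n : ℕ) : (maxNilIdealC F).toIdeal := (TateModule.proj p n τ).val

/-- Unfolding `seq`. [cite: SilvermanAEC2009, III.§7] -/
theorem seq_apply (τ : TatePt F p W) (n : ℕ) : seq W τ n = (TateModule.proj p n τ).val := rfl

/-- `t₀ = 0` (the level-`0` component is killed by `p⁰ = 1`). [cite: SilvermanAEC2009, III.§7] -/
theorem seq_zero (τ : TatePt F p W) : (seq W τ 0 : CBall F) = 0 := by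
  have h := TateModule.pow_smul_proj 0 τ
  rw [pow_zero, one_smul] at h
  rw [seq_apply, h, WeierstrassCurve.Pt.val_zero]
  rfl

/-- `[p]_W t_{n+1} = t_n`. [cite: SilvermanAEC2009, III.§7] -/
theorem mulPC_seq (τ : TatePt F p W) (n : ℕ) : mulPC F p W (seq W τ (n + 1)) = seq W τ n := by
  rw [seq_apply, seq_apply, ← val_p_nsmul, TateModule.smul_proj_succ]

/-- `pⁿ • t_n = 0` for a `[p]`-compatible sequence with `t₀ = 0`. [cite: SilvermanAEC2009, III.§7] -/
theorem pow_nsmul_eq_zero_of_seq {t : ℕ → (maxNilIdealC F).toIdeal} (ht0 : (t 0 : CBall F) = 0)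
    (htp : ∀ n, mulPC F p W (t (n + 1)) = t n) (n : ℕ) : p ^ n • (⟨t n⟩ : W.Pt (maxNilIdealC F)) = 0 := by
  induction n with
  | zero => rw [pow_zero, one_smul]; exact WeierstrassCurve.Pt.ext (Subtype.ext ht0)
  | succ n ih =>
    have h : p • (⟨t (n + 1)⟩ : W.Pt (maxNilIdealC F)) = ⟨t n⟩ :=
      WeierstrassCurve.Pt.ext ((val_p_nsmul F W _).trans (htp n))
    rw [pow_succ, mul_nsmul', h, ih]

/-- **The bridge**: a `[p]`-compatible sequence `t` of points of `Ŵ(𝔪_{ℂ_F})` with `t₀ = 0` IS an element of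
`T_pŴ(𝒪_{ℂ_F})`. [cite: SilvermanAEC2009, III.§7] -/
def ofSeq (t : ℕ → (maxNilIdealC F).toIdeal) (ht0 : (t 0 : CBall F) = 0)
    (htp : ∀ n, mulPC F p W (t (n + 1)) = t n) : TatePt F p W :=
  TateModule.mk (fun n => (⟨t n⟩ : W.Pt (maxNilIdealC F))) (pow_nsmul_eq_zero_of_seq W ht0 htp)
    fun n => WeierstrassCurve.Pt.ext ((val_p_nsmul F W _).trans (htp n))

/-- `seq (ofSeq t) = t`. [cite: SilvermanAEC2009, III.§7] -/
@[simp] theorem seq_ofSeq (t : ℕ → (maxNilIdealC F).toIdeal) (ht0 : (t 0 : CBall F) = 0)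
    (htp : ∀ n, mulPC F p W (t (n + 1)) = t n) : seq W (ofSeq W t ht0 htp) = t := rfl

/-- `ofSeq (seq τ) = τ`. [cite: SilvermanAEC2009, III.§7] -/
@[simp] theorem ofSeq_seq (τ : TatePt F p W) : ofSeq W (seq W τ) (seq_zero W τ) (mulPC_seq W τ) = τ :=
  TateModule.ext fun _ => rfl

/-- `seq` is injective. [cite: SilvermanAEC2009, III.§7] -/
theorem seq_injective : Function.Injective (seq (F := F) (p := p) W) := fun _ _ h =>
  TateModule.ext fun n => WeierstrassCurve.Pt.ext (congrFun h n)

/-- **Addition**: `seq (τ + τ') = seq τ ⊕_W seq τ'` termwise (`addSeq`). [cite: SilvermanAEC2009, III.§7] -/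
theorem seq_add (τ τ' : TatePt F p W) : seq W (τ + τ') = addSeq F W (seq W τ) (seq W τ') := rfl

/-- **Galois**: `seq (σ • τ) = σ ∘ seq τ` (`galSeq`). [cite: FontaineAsterisque223III, Exp. II §1.2] -/
theorem seq_smul (σ : absoluteGaloisGroup F) (τ : TatePt F p W) : seq W (σ • τ) = galSeq F σ (seq W τ) := rfl

/-- `seq 0 = 0`. [cite: SilvermanAEC2009, III.§7] -/
@[simp] theorem seq_zero_elem (n : ℕ) : (seq W (0 : TatePt F p W) n : CBall F) = 0 := rfl

end Tate

/-! ## §3 The period maps as bundled equivariant homomorphisms -/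

section Periods

variable {F : Type} [Field F] [ValuativeRel F] [TopologicalSpace F] [IsNonarchimedeanLocalField F]
  {p : ℕ} [Fact p.Prime] [Fact (¬ IsUnit (p : integerC F))]
  [IsAdicComplete (Ideal.span {(p : integerC F)}) (integerC F)] [CharZero F]
  {hθ : Function.Surjective (fontaineTheta (integerC F) p)}
  (W : WeierstrassCurve ℤ)

/-- Congruence for `torsionLift` in the sequence. [cite: FontaineAsterisque223III, Exp. II §1.2.2] -/
theorem torsionLift_congr_seq {t t' : ℕ → (maxNilIdealC F).toIdeal} (h : t = t')
    (htp : ∀ n, mulPC F p W (t (n + 1)) = t n) (htp' : ∀ n, mulPC F p W (t' (n + 1)) = t' n) :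
    torsionLift W hθ t htp = torsionLift W hθ t' htp' := by subst h; rfl

/-- Congruence for `omegaPeriod` in the sequence. [cite: Fontaine1982FormesDifferentielles, §5] -/
theorem omegaPeriod_congr_seq {t t' : ℕ → (maxNilIdealC F).toIdeal} (h : t = t')
    (ht0 : (t 0 : CBall F) = 0) (htp : ∀ n, mulPC F p W (t (n + 1)) = t n)
    (ht0' : (t' 0 : CBall F) = 0) (htp' : ∀ n, mulPC F p W (t' (n + 1)) = t' n) :
    omegaPeriod W hθ t ht0 htp = omegaPeriod W hθ t' ht0' htp' := by subst h; rfl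

/-- Congruence for `htCoord` in the sequence. [cite: Fontaine1982FormesDifferentielles, §5] -/
theorem htCoord_congr_seq {t t' : ℕ → (maxNilIdealC F).toIdeal} (h : t = t')
    (ht0 : (t 0 : CBall F) = 0) (htp : ∀ n, mulPC F p W (t (n + 1)) = t n)
    (ht0' : (t' 0 : CBall F) = 0) (htp' : ∀ n, mulPC F p W (t' (n + 1)) = t' n) :
    htCoord W hθ t ht0 htp = htCoord W hθ t' ht0' htp' := by subst h; rfl

/-- **Fontaine's element as a homomorphism `T_pŴ(𝒪_{ℂ_F}) →+ Ŵ(𝔫)`, `τ ↦ [τ] = lim [pⁿ]_W(τ̂_n)`** (additive by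
`torsionLift_addSeq`; `[τ] ∈ 𝔫` by `flim_mem_nilTheta`). [cite: FontaineAsterisque223III, Exp. II §1.2.2] -/
def torsionLiftHom (hθ : Function.Surjective (fontaineTheta (integerC F) p)) : TatePt F p W →+ W.Pt (nilTheta F p hθ) :=
  AddMonoidHom.mk' (fun τ => ⟨⟨torsionLift W hθ (seq W τ) (mulPC_seq W τ), flim_mem_nilTheta _ _⟩⟩) fun τ τ' =>
    WeierstrassCurve.Pt.ext (Subtype.ext (by
      rw [val_add_N]
      exact (torsionLift_congr_seq W (seq_add W τ τ') (mulPC_seq W (τ + τ')) (mulPC_addSeq W (mulPC_seq W τ) (mulPC_seq W τ'))).trans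
        (torsionLift_addSeq W (hθ := hθ) (mulPC_seq W τ) (mulPC_seq W τ'))))

/-- Unfolding `torsionLiftHom`. [cite: FontaineAsterisque223III, Exp. II §1.2.2] -/
theorem coe_val_torsionLiftHom (τ : TatePt F p W) :
    ((torsionLiftHom W hθ τ).val : AinfTop F p) = torsionLift W hθ (seq W τ) (mulPC_seq W τ) := rfl

/-- `θ([τ]) = 0`. [cite: FontaineAsterisque223III, Exp. II §1.2.2] -/
theorem theta_torsionLiftHom (τ : TatePt F p W) : theta F p ((torsionLiftHom W hθ τ).val : AinfTop F p) = 0 :=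
  theta_torsionLift W (seq_zero W τ) (mulPC_seq W τ)

/-- **`Γ_F`-equivariance `σ[τ] = [σ τ]`.** [cite: FontaineAsterisque223III, Exp. II §1.2] -/
theorem galPtN_torsionLiftHom (σ : absoluteGaloisGroup F) (τ : TatePt F p W) :
    galPtN W hθ σ (torsionLiftHom W hθ τ) = torsionLiftHom W hθ (σ • τ) :=
  WeierstrassCurve.Pt.ext (Subtype.ext (by
    rw [coe_val_galPtN, coe_val_torsionLiftHom, coe_val_torsionLiftHom, gal_torsionLift W σ (mulPC_seq W τ)]
    exact torsionLift_congr_seq W (seq_smul W σ τ).symm _ _))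

/-- **The ω-period as a homomorphism `T_pŴ(𝒪_{ℂ_F}) →+ B_dR⁺(F)`, `τ ↦ ∫_τ ω = log_W([τ])`** (additive by
`omegaPeriod_addSeq`). [cite: Fontaine1982FormesDifferentielles, §5] -/
def omegaPeriodHom (hθ : Function.Surjective (fontaineTheta (integerC F) p)) : TatePt F p W →+ BdRPlusTop F p :=
  AddMonoidHom.mk' (fun τ => omegaPeriod W hθ (seq W τ) (seq_zero W τ) (mulPC_seq W τ)) fun τ τ' =>
    (omegaPeriod_congr_seq W (seq_add W τ τ') _ _ (coe_addSeq_zero W (seq_zero W τ) (seq_zero W τ'))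
      (mulPC_addSeq W (mulPC_seq W τ) (mulPC_seq W τ'))).trans
      (omegaPeriod_addSeq W (hθ := hθ) (seq_zero W τ) (seq_zero W τ') (mulPC_seq W τ) (mulPC_seq W τ'))

/-- Unfolding `omegaPeriodHom`. [cite: Fontaine1982FormesDifferentielles, §5] -/
theorem omegaPeriodHom_apply (τ : TatePt F p W) :
    omegaPeriodHom W hθ τ = omegaPeriod W hθ (seq W τ) (seq_zero W τ) (mulPC_seq W τ) := rfl

/-- **`∫_τ ω ∈ Fil¹ B_dR⁺`.** [cite: Fontaine1982FormesDifferentielles, §5] -/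
theorem omegaPeriodHom_mem_filOne (τ : TatePt F p W) : omegaPeriodHom W hθ τ ∈ (BdRPlusTop.filOne F p).toIdeal :=
  omegaPeriod_mem_filOne W (seq_zero W τ) (mulPC_seq W τ)

/-- **`Γ_F`-equivariance of the ω-period: `σ(∫_τ ω) = ∫_{σ τ} ω`.** [cite: Fontaine1982FormesDifferentielles, §5]
[cite: FontaineAsterisque223III, Exp. II §1.5.4] -/
theorem gal_omegaPeriodHom (σ : absoluteGaloisGroup F) (τ : TatePt F p W) :
    BdRPlusTop.gal F p σ (omegaPeriodHom W hθ τ) = omegaPeriodHom W hθ (σ • τ) := by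
  rw [omegaPeriodHom_apply, omegaPeriodHom_apply, gal_omegaPeriod W σ (seq_zero W τ) (mulPC_seq W τ)]
  exact omegaPeriod_congr_seq W (seq_smul W σ τ).symm _ _ _ _

/-- **The ω-period is `ℤ`-linear**: `∫_{n τ} ω = n ∫_τ ω`. [cite: Fontaine1982FormesDifferentielles, §5] -/
theorem omegaPeriodHom_zsmul (n : ℤ) (τ : TatePt F p W) : omegaPeriodHom W hθ (n • τ) = n • omegaPeriodHom W hθ τ :=
  map_zsmul _ n τ

/-- **The Hodge–Tate map as a homomorphism `T_pŴ(𝒪_{ℂ_F}) →+ ℂ_F`, `τ ↦ θ([τ]/ξ_dR)`** (additive by `htCoord_addSeq`).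
[cite: Tate1967, §4] [cite: Fontaine1982FormesDifferentielles, §5] -/
def htCoordHom (hθ : Function.Surjective (fontaineTheta (integerC F) p)) : TatePt F p W →+ CompletedAlgClosure F :=
  AddMonoidHom.mk' (fun τ => htCoord W hθ (seq W τ) (seq_zero W τ) (mulPC_seq W τ)) fun τ τ' =>
    (htCoord_congr_seq W (seq_add W τ τ') _ _ (coe_addSeq_zero W (seq_zero W τ) (seq_zero W τ'))
      (mulPC_addSeq W (mulPC_seq W τ) (mulPC_seq W τ'))).trans
      (htCoord_addSeq W (hθ := hθ) (seq_zero W τ) (seq_zero W τ') (mulPC_seq W τ) (mulPC_seq W τ'))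

/-- Unfolding `htCoordHom`. [cite: Tate1967, §4] -/
theorem htCoordHom_apply (τ : TatePt F p W) :
    htCoordHom W hθ τ = htCoord W hθ (seq W τ) (seq_zero W τ) (mulPC_seq W τ) := rfl

/-- **Galois rule of the Hodge–Tate map: `HT(σ τ) = c(σ) · σ(HT τ)`**, `c(σ) = θ(σξ_dR/ξ_dR)` the cyclotomic-type cocycle of
`gr¹B_dR ≅ ℂ_F(1)` — i.e. `HT : T_pŴ(𝒪_{ℂ_F}) → ℂ_F(1)` is `Γ_F`-equivariant. [cite: Tate1967, §4] [cite: FontaineAsterisque223III, Exp. II §1.5.5] -/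
theorem htCoordHom_smul (σ : absoluteGaloisGroup F) (τ : TatePt F p W) :
    htCoordHom W hθ (σ • τ) = BdRPlusTop.xiCocycle (p := p) σ * σ • htCoordHom W hθ τ := by
  rw [htCoordHom_apply, htCoordHom_apply, ← htCoord_galSeq W σ (seq_zero W τ) (mulPC_seq W τ)]
  exact htCoord_congr_seq W (seq_smul W σ τ) _ _ _ _

/-- `HT(τ) = 0 ↔ [τ] ∈ Fil² B_dR⁺` (`↔` the Hodge–Tate class of `τ` vanishes). [cite: Fontaine1982FormesDifferentielles, §5] -/
theorem htCoordHom_eq_zero_iff (τ : TatePt F p W) :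
    htCoordHom W hθ τ = 0 ↔ htClass W hθ (seq W τ) (seq_zero W τ) (mulPC_seq W τ) = 0 :=
  htCoord_eq_zero_iff W (seq_zero W τ) (mulPC_seq W τ)

/-- **The Hodge–Tate map is `ℤ`-linear**: `HT(n τ) = n · HT(τ)`. [cite: Tate1967, §4] -/
theorem htCoordHom_zsmul (n : ℤ) (τ : TatePt F p W) : htCoordHom W hθ (n • τ) = n • htCoordHom W hθ τ :=
  map_zsmul _ n τ

end Periods

end AinfTop

end Literature.NumberTheory.PAdicHodge

end
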